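import Mathlib
import HarnessLib
import Summits.HubbardSuperconductivity.HubbardSuperconductivity.Theorems.KLProgrammeKLRegimeEngineV8DefsQ3
import Summits.HubbardSuperconductivity.HubbardSuperconductivity.Theorems.KLProgrammeKLRegimeEnginePackageSmallness

/-!
# Route `KLProgramme` — crux K3, ENGINE child (gen-4 successor of stmt-HubbardSuperconductivity-19823): the `U`-SMALLNESS of the one-slice
# pair-ladder resummation AT THE v3 ENGINE PACKAGE `klEngQ3 / klEngU₀3` (p1 g7, `…EngineV8DefsQ3`, k3c2-p1 g2's Q3-a ask)

Cell gate-hubbard-kl, seat hubbard-kl-k3c1-p1 (g4).  `…EnginePackageSmallness` (this seat, g2) discharged the `hsmall` hypothesis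
`G.bhi·(2|U| + D·U²) ≤ 1/3`, `D = P.C_W + klLegKappa·Q.CR·P.Klam³`, of the (E2)-clause constructors (`pairLadderStepAtV7/V8_of_expansion{,_unif,_unif'}`,
`klpli_pair_witness`, k3c1-p2's `klEngine_resummation_exists`) at the v1 package (`Q = klEngQ`, `U ≤ klEngU₀`).  The gen-4 engine skeleton is
registered at the v3 package (`Q := klEngQ3 P R`, every `Q`-slack `= 2^{60}·klEngPsq P²·klEngRsq R²`; `U ≤ klEngU₀3 P R c = 2^{-120}/(klEngPsq²·
klEngRsq⁴·(c²+1))`), where `D` is LARGER — so the v1 lemma does not transfer by monotonicity and is re-proved here, once, GENERIC in the bubble-mass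
number `b` (any `b ≤ 2^{100}`, so a later `G`-package with `bhi = 2^{18}` or more is covered without a new file):
`klEng_pairTolerance3_le` (`D ≤ 2^{73}·klEngPsq⁴·klEngRsq²`), `klEng_pairTolerance3_nonneg`, `klEngU₀3_mul_denominator`,
**`klEng_pair_smallness3`** (`P.WF → b ≤ 2^{100} → 0 ≤ U ≤ klEngU₀3 P R c → b·(2|U| + D·U²) ≤ 1/3`, in fact `≤ 2^{-18}`), and the instances
`klEng_pair_smallness3_geo` (`b = klEngGeo.bhi = 4`) and `klEng_pair_smallness3_of_le` (`b ≤ 2^{100}` read from any `G` with `G.bhi ≤ 2^{100}`).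
Arithmetic only; nothing about the model is asserted.  0 kit.
-/

noncomputable section

namespace Summit.HubbardSuperconductivity.HubbardSuperconductivity.Theorems.EngineV8

set_option linter.dupNamespace false -- summit = problem name (single-conjunct summit), D-0017

open Real Finset
open Summit.HubbardSuperconductivity.HubbardSuperconductivity.Theorems.KLRegimeSplit

/-- The `Q3`-aware pair-array tolerance constant is nonnegative: `0 ≤ P.C_W + klLegKappa·(klEngQ3 P R).CR·P.Klam³` (`P.WF`). -/
theorem klEng_pairTolerance3_nonneg {P : SplitConsts} (hP : P.WF) (R : RenConsts) :
    0 ≤ P.C_W + klLegKappa * (klEngQ3 P R).CR * P.Klam ^ 3 := by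
  obtain ⟨hK, hCW, -⟩ := hP
  have hCR : 0 ≤ (klEngQ3 P R).CR := (klEngQ3_wf P R).2.1
  have hK0 : 0 ≤ P.Klam := zero_le_one.trans hK
  unfold klLegKappa
  positivity

/-- **The v3 tolerance constant against the package's polynomial sizes**:
`P.C_W + klLegKappa·(klEngQ3 P R).CR·P.Klam³ ≤ 2^{73}·klEngPsq P⁴·klEngRsq R²` (`P.WF` for `Klam ≥ 1`; uses `C_W ≤ klEngPsq`,
`Klam³ ≤ klEngPsq²`, `klLegKappa = 4000 ≤ 2^{12}`). -/
theorem klEng_pairTolerance3_le {P : SplitConsts} (hP : P.WF) (R : RenConsts) :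
    P.C_W + klLegKappa * (klEngQ3 P R).CR * P.Klam ^ 3 ≤ (2 : ℝ) ^ 73 * klEngPsq P ^ 4 * klEngRsq R ^ 2 := by
  obtain ⟨hK, hCW, hCd⟩ := hP
  have hA1 : 1 ≤ klEngPsq P := one_le_klEngPsq P
  have hB1 : 1 ≤ klEngRsq R := one_le_klEngRsq R
  have hA0 : 0 ≤ klEngPsq P := zero_le_one.trans hA1
  have hB0 : 0 ≤ klEngRsq R := zero_le_one.trans hB1
  have hK0 : 0 ≤ P.Klam := zero_le_one.trans hK
  -- `C_W ≤ Psq`, `Klam² ≤ Psq`, `Klam³ ≤ Psq²`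
  have hCWA : P.C_W ≤ klEngPsq P := by
    unfold klEngPsq; nlinarith [sq_nonneg (P.C_W - 1), sq_nonneg P.Klam, sq_nonneg P.Cd]
  have hK2A : P.Klam ^ 2 ≤ klEngPsq P := by
    unfold klEngPsq; nlinarith [sq_nonneg P.C_W, sq_nonneg P.Cd]
  have hK3 : P.Klam ^ 3 ≤ klEngPsq P ^ 2 := by
    calc P.Klam ^ 3 = P.Klam ^ 2 * P.Klam := by ring
      _ ≤ P.Klam ^ 2 * P.Klam ^ 2 := by
          apply mul_le_mul_of_nonneg_left _ (sq_nonneg _)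
          nlinarith
      _ = (P.Klam ^ 2) ^ 2 := by ring
      _ ≤ klEngPsq P ^ 2 := pow_le_pow_left₀ (sq_nonneg _) hK2A 2
  have hCR : (klEngQ3 P R).CR = 2 ^ 60 * klEngPsq P ^ 2 * klEngRsq R ^ 2 := rfl
  rw [hCR]
  unfold klLegKappa
  -- the cubic term
  have h1 : (4000 : ℝ) * (2 ^ 60 * klEngPsq P ^ 2 * klEngRsq R ^ 2) * P.Klam ^ 3 ≤ 2 ^ 72 * klEngPsq P ^ 4 * klEngRsq R ^ 2 := by
    have h4000 : (4000 : ℝ) ≤ 2 ^ 12 := by norm_num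
    calc (4000 : ℝ) * (2 ^ 60 * klEngPsq P ^ 2 * klEngRsq R ^ 2) * P.Klam ^ 3
        = 4000 * (2 ^ 60 * (klEngPsq P ^ 2 * klEngRsq R ^ 2 * P.Klam ^ 3)) := by ring
      _ ≤ 2 ^ 12 * (2 ^ 60 * (klEngPsq P ^ 2 * klEngRsq R ^ 2 * klEngPsq P ^ 2)) := by
          apply mul_le_mul h4000 _ (by positivity) (by positivity)
          apply mul_le_mul_of_nonneg_left _ (by positivity)
          exact mul_le_mul_of_nonneg_left hK3 (by positivity)
      _ = 2 ^ 72 * klEngPsq P ^ 4 * klEngRsq R ^ 2 := by ring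
  -- the constant term
  have h2 : P.C_W ≤ 2 ^ 72 * klEngPsq P ^ 4 * klEngRsq R ^ 2 := by
    have h3 : klEngPsq P ≤ klEngPsq P ^ 4 * klEngRsq R ^ 2 := by
      calc klEngPsq P = klEngPsq P * 1 * 1 := by ring
        _ ≤ klEngPsq P * klEngPsq P ^ 3 * klEngRsq R ^ 2 :=
            mul_le_mul (mul_le_mul_of_nonneg_left (one_le_pow₀ hA1) hA0) (one_le_pow₀ hB1) zero_le_one (by positivity)
        _ = klEngPsq P ^ 4 * klEngRsq R ^ 2 := by ring
    have h4 : klEngPsq P ^ 4 * klEngRsq R ^ 2 ≤ 2 ^ 72 * klEngPsq P ^ 4 * klEngRsq R ^ 2 := by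
      have : (0 : ℝ) ≤ klEngPsq P ^ 4 * klEngRsq R ^ 2 := by positivity
      nlinarith
    linarith
  have h272 : (2 : ℝ) ^ 72 * klEngPsq P ^ 4 * klEngRsq R ^ 2 + 2 ^ 72 * klEngPsq P ^ 4 * klEngRsq R ^ 2
      = 2 ^ 73 * klEngPsq P ^ 4 * klEngRsq R ^ 2 := by ring
  linarith

/-- `klEngU₀3 P R c` times its denominator is `1`. -/
theorem klEngU₀3_mul_denominator (P : SplitConsts) (R : RenConsts) (c : ℝ) :
    klEngU₀3 P R c * ((2 : ℝ) ^ 120 * klEngPsq P ^ 2 * klEngRsq R ^ 4 * (c ^ 2 + 1)) = 1 := by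
  unfold klEngU₀3
  have hp := klEngPsq_pos P
  have hr := klEngRsq_pos R
  have : 0 < (2 : ℝ) ^ 120 * klEngPsq P ^ 2 * klEngRsq R ^ 4 * (c ^ 2 + 1) := by positivity
  field_simp

/-- **The `U`-smallness of the one-slice pair-ladder resummation at the v3 engine package, generic in the bubble-mass number.**
For `P.WF`, `b ≤ 2^{100}` (no sign needed), `0 ≤ U ≤ klEngU₀3 P R c`:
`b·(2|U| + (P.C_W + klLegKappa·(klEngQ3 P R).CR·P.Klam³)·U²) ≤ 1/3` — the `hsmall` hypothesis of `pairLadderStepAtV8_of_expansion{,_unif,_unif'}` /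
`pairLadderStepAtV7_of_expansion` / `klpli_pair_witness` at `Q = klEngQ3 P R` for ANY `G` with `G.bhi = b ≤ 2^{100}` (and, a fortiori, k3c1-p2's
`(Σ w)·D·U² ≤ 1/3` for `Σ w ≤ b`).  Proof: `U ≤ X⁻¹`, `X = 2^{120}·Psq²·Rsq⁴·(c²+1) ≥ 2^{120}`, `D ≤ 2^{73}·Psq⁴·Rsq² ≤ 2^{-167}·X²`. -/
theorem klEng_pair_smallness3 {P : SplitConsts} (hP : P.WF) (R : RenConsts) (c : ℝ) {b U : ℝ} (hb : b ≤ (2 : ℝ) ^ 100)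
    (hU0 : 0 ≤ U) (hU : U ≤ klEngU₀3 P R c) :
    b * (2 * |U| + (P.C_W + klLegKappa * (klEngQ3 P R).CR * P.Klam ^ 3) * U ^ 2) ≤ 1 / 3 := by
  rw [abs_of_nonneg hU0]
  -- abbreviations (plain reals, no `set`)
  obtain ⟨A, hA_def⟩ : ∃ A : ℝ, A = klEngPsq P := ⟨_, rfl⟩
  obtain ⟨B, hB_def⟩ : ∃ B : ℝ, B = klEngRsq R := ⟨_, rfl⟩
  obtain ⟨Cc, hCc_def⟩ : ∃ Cc : ℝ, Cc = c ^ 2 + 1 := ⟨_, rfl⟩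
  have hA1 : 1 ≤ A := by rw [hA_def]; exact one_le_klEngPsq P
  have hB1 : 1 ≤ B := by rw [hB_def]; exact one_le_klEngRsq R
  have hC1 : 1 ≤ Cc := by rw [hCc_def]; nlinarith [sq_nonneg c]
  have hA0 : 0 ≤ A := zero_le_one.trans hA1
  have hB0 : 0 ≤ B := zero_le_one.trans hB1
  have hC0 : 0 ≤ Cc := zero_le_one.trans hC1
  obtain ⟨X, hX_def⟩ : ∃ X : ℝ, X = (2 : ℝ) ^ 120 * A ^ 2 * B ^ 4 * Cc := ⟨_, rfl⟩
  have hX120 : (2 : ℝ) ^ 120 ≤ X := by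
    rw [hX_def]
    have h1 : 1 ≤ A ^ 2 := one_le_pow₀ hA1
    have h2 : 1 ≤ B ^ 4 := one_le_pow₀ hB1
    calc (2 : ℝ) ^ 120 = 2 ^ 120 * 1 * 1 * 1 := by ring
      _ ≤ 2 ^ 120 * A ^ 2 * B ^ 4 * Cc := by gcongr
  have hX : 0 < X := lt_of_lt_of_le (by positivity) hX120
  have hU₀X : klEngU₀3 P R c * X = 1 := by
    rw [hX_def, hA_def, hB_def, hCc_def]; exact klEngU₀3_mul_denominator P R c
  have hU₀ : klEngU₀3 P R c = X⁻¹ := eq_inv_of_mul_eq_one_left hU₀X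
  -- the tolerance constant against `X²`
  have hDX : P.C_W + klLegKappa * (klEngQ3 P R).CR * P.Klam ^ 3 ≤ ((2 : ℝ) ^ 167)⁻¹ * X ^ 2 := by
    refine (klEng_pairTolerance3_le hP R).trans ?_
    rw [← hA_def, ← hB_def]
    have h1 : A ^ 4 * B ^ 2 ≤ A ^ 4 * B ^ 8 * Cc ^ 2 := by
      have hB6 : 1 ≤ B ^ 6 := one_le_pow₀ hB1
      have hC2 : 1 ≤ Cc ^ 2 := one_le_pow₀ hC1
      calc A ^ 4 * B ^ 2 = A ^ 4 * B ^ 2 * 1 * 1 := by ring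
        _ ≤ A ^ 4 * B ^ 2 * B ^ 6 * Cc ^ 2 := by gcongr
        _ = A ^ 4 * B ^ 8 * Cc ^ 2 := by ring
    calc (2 : ℝ) ^ 73 * A ^ 4 * B ^ 2 = 2 ^ 73 * (A ^ 4 * B ^ 2) := by ring
      _ ≤ 2 ^ 73 * (A ^ 4 * B ^ 8 * Cc ^ 2) := by gcongr
      _ = ((2 : ℝ) ^ 167)⁻¹ * X ^ 2 := by rw [hX_def]; ring
  -- `U ≤ X⁻¹ ≤ 2^{-120}` and `D·U² ≤ 2^{-167}`
  have hUX : U ≤ X⁻¹ := by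
    calc U ≤ klEngU₀3 P R c := hU
      _ = X⁻¹ := hU₀
  have hU120 : U ≤ ((2 : ℝ) ^ 120)⁻¹ := hUX.trans (inv_anti₀ (by positivity) hX120)
  have hU2 : U ^ 2 ≤ (X⁻¹) ^ 2 := pow_le_pow_left₀ hU0 hUX 2
  have hD0 : 0 ≤ P.C_W + klLegKappa * (klEngQ3 P R).CR * P.Klam ^ 3 := klEng_pairTolerance3_nonneg hP R
  have hDU : (P.C_W + klLegKappa * (klEngQ3 P R).CR * P.Klam ^ 3) * U ^ 2 ≤ ((2 : ℝ) ^ 167)⁻¹ := by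
    have hXX : X ^ 2 * (X⁻¹) ^ 2 = 1 := by rw [inv_pow, mul_inv_cancel₀ (pow_ne_zero 2 hX.ne')]
    calc (P.C_W + klLegKappa * (klEngQ3 P R).CR * P.Klam ^ 3) * U ^ 2
        ≤ (((2 : ℝ) ^ 167)⁻¹ * X ^ 2) * (X⁻¹) ^ 2 := mul_le_mul hDX hU2 (sq_nonneg U) (by positivity)
      _ = ((2 : ℝ) ^ 167)⁻¹ * (X ^ 2 * (X⁻¹) ^ 2) := by ring
      _ = ((2 : ℝ) ^ 167)⁻¹ := by rw [hXX, mul_one]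
  -- assemble: `b·(2U + DU²) ≤ 2^{100}·(2·2^{-120} + 2^{-167}) ≤ 1/3`
  have hsum : 2 * U + (P.C_W + klLegKappa * (klEngQ3 P R).CR * P.Klam ^ 3) * U ^ 2 ≤ 2 * ((2 : ℝ) ^ 120)⁻¹ + ((2 : ℝ) ^ 167)⁻¹ := by
    linarith
  have hsum0 : 0 ≤ 2 * U + (P.C_W + klLegKappa * (klEngQ3 P R).CR * P.Klam ^ 3) * U ^ 2 := by positivity
  calc b * (2 * U + (P.C_W + klLegKappa * (klEngQ3 P R).CR * P.Klam ^ 3) * U ^ 2)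
      ≤ (2 : ℝ) ^ 100 * (2 * ((2 : ℝ) ^ 120)⁻¹ + ((2 : ℝ) ^ 167)⁻¹) := mul_le_mul hb hsum hsum0 (by positivity)
    _ ≤ 1 / 3 := by norm_num

/-- **Instance at the frozen `G`-package**: `klEngGeo.bhi·(2|U| + (P.C_W + klLegKappa·(klEngQ3 P R).CR·P.Klam³)·U²) ≤ 1/3` for `P.WF`,
`0 ≤ U ≤ klEngU₀3 P R c` (`klEngGeo.bhi = 4`). -/
theorem klEng_pair_smallness3_geo {P : SplitConsts} (hP : P.WF) (R : RenConsts) (c : ℝ) {U : ℝ} (hU0 : 0 ≤ U) (hU : U ≤ klEngU₀3 P R c) :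
    klEngGeo.bhi * (2 * |U| + (P.C_W + klLegKappa * (klEngQ3 P R).CR * P.Klam ^ 3) * U ^ 2) ≤ 1 / 3 := by
  have hbhi : klEngGeo.bhi = 4 := rfl
  rw [hbhi]
  exact klEng_pair_smallness3 hP R c (by norm_num) hU0 hU

/-- **Instance for any `G`-package with `G.bhi ≤ 2^{100}`** (e.g. a re-typed `bhi := 2^{18}`):
`G.bhi·(2|U| + (P.C_W + klLegKappa·(klEngQ3 P R).CR·P.Klam³)·U²) ≤ 1/3` for `P.WF`, `0 ≤ U ≤ klEngU₀3 P R c`. -/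
theorem klEng_pair_smallness3_of_le {G : GeoConsts} (hG : G.bhi ≤ (2 : ℝ) ^ 100) {P : SplitConsts} (hP : P.WF)
    (R : RenConsts) (c : ℝ) {U : ℝ} (hU0 : 0 ≤ U) (hU : U ≤ klEngU₀3 P R c) :
    G.bhi * (2 * |U| + (P.C_W + klLegKappa * (klEngQ3 P R).CR * P.Klam ^ 3) * U ^ 2) ≤ 1 / 3 :=
  klEng_pair_smallness3 hP R c hG hU0 hU

/-- The same smallness with `|U|` in the hypothesis instead of a sign (`|U| ≤ klEngU₀3 P R c`), for consumers that carry `|U|`: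
`b·(2|U| + D·|U|²) ≤ 1/3`, stated with `U²` (`= |U|²`). -/
theorem klEng_pair_smallness3_abs {P : SplitConsts} (hP : P.WF) (R : RenConsts) (c : ℝ) {b U : ℝ} (hb : b ≤ (2 : ℝ) ^ 100)
    (hU : |U| ≤ klEngU₀3 P R c) :
    b * (2 * |U| + (P.C_W + klLegKappa * (klEngQ3 P R).CR * P.Klam ^ 3) * U ^ 2) ≤ 1 / 3 := by
  have h := klEng_pair_smallness3 hP R c hb (abs_nonneg U) hU
  rw [abs_abs, sq_abs] at h
  exact h

end Summit.HubbardSuperconductivity.HubbardSuperconductivity.Theorems.EngineV8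

end
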